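import Literature.Probability.LatticeModels.CurrentsPartialMonotonicity
import Mathlib.Logic.Function.DependsOn
import HarnessLib

/-!
# The localized switching identity of Aizenman–Duminil-Copin 2021 ((4.10)/(6.14): switching the sources inside `Λ_n` without touching the outside of `Λ_N`)

Topic `Literature/Probability/LatticeModels`. The mixing property of random currents — "the crux of
the whole paper" (M. Aizenman, H. Duminil-Copin, *Marginal triviality of the scaling limits of critical
4D Ising and `φ⁴₄` models*, Ann. of Math. **194** (2021), arXiv:1912.07973, Prop. 4.6 and Thm 6.4)
— rests on the following use of the switching principle (ibid., §4.2, proof of Prop. 4.6, display (4.10)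
and the paragraph after it; §6.2, display (6.14)):

  "fix `y ∈ Ann(m,M)` and let `G(y)` be the event (depending on `n₁+n₂` only) that there exists
  `𝐤 ≤ n₁+n₂` such that `𝐤 = 0` on `Λ_n`, `𝐤 = n₁+n₂` outside `Λ_N`, and `∂𝐤 = {x,y}`. We find that
  `P^{0x,∅}[n₁ ∈ E ∩ F, y ↔ 0 in n₁+n₂, G(y)] = (⟨σ₀σ_y⟩⟨σ_yσ_x⟩/⟨σ₀σ_x⟩) P^{0y,yx}[n₁ ∈ E, n₂ ∈ F, G(y)]`,
  where we use the following reasoning: for `𝐦 ∈ G(y)`, consider the multi-graph `ℳ` obtained by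
  duplicating every edge of the graph into `𝐦(x,y)` edges. If `G(y)` occurs, the existence of `𝐤`
  guarantees the existence of a subgraph `𝒦 ⊂ ℳ` with `∂𝒦 = {x,y}` containing no edge with
  endpoints in `Λ_n` and all those of `ℳ` with endpoints outside `Λ_N`, so that the generalized
  switching principle … implies that
  `∑_{𝒩 ⊂ ℳ : ∂𝒩 = {0,x}} 𝕀[𝒩 ∈ E ∩ F] = ∑_{𝒩 : ∂(𝒩Δ𝒦) = {0,x}} 𝕀[𝒩Δ𝒦 ∈ E ∩ F] = ∑_{𝒩 : ∂𝒩 = {0,y}} 𝕀[𝒩 ∈ E, ℳ ∖ 𝒩 ∈ F]`"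

(`E` an event depending on the edges within `Λ_n`, `F` on the edges outside `Λ_N`). This file proves
that identity for edge couplings `K ≥ 0` on a finite simple graph (`WeightedCurrents.lean`), in
un-normalised current-sum form and for arbitrary `ℝ≥0∞`-valued functionals `E`, `F` that are **local**
on two sets of edges `E_in`, `E_out` (Mathlib's `DependsOn E ↑E_in`, `DependsOn F ↑E_out`), with the event
`Current.SplitEvent E_in E_out u y m := ∃ k ≤ m, k|_{E_in} = 0 ∧ k|_{E_out} = m|_{E_out} ∧ ∂k = {u} Δ {y}`:

* `Current.tsum_epairWeight_switch_local` — **(6.14) for one pair of currents** (printed sources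
  `{0,x} = {x} Δ {y}` here, switch point `u`):
  `∑ 1{∂n₁={x,y}}1{∂n₂=∅} w w E(n₁) F(n₁) 𝟙[G_u(n₁+n₂)] = ∑ 1{∂n₁={x,u}}1{∂n₂={u,y}} w w E(n₁) F(n₂) 𝟙[G_u(n₁+n₂)]`;
  after division by `Z[xy]Z[∅]` resp. `Z[xu]Z[uy]` this is the display, the ratio of normalisations
  being `a_{x,y}(u) = ⟨σ_xσ_u⟩⟨σ_uσ_y⟩/⟨σ_xσ_y⟩`;
* `Current.tsum_epairWeight_switch_local_conn` — the same with the printed extra indicator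
  `𝟙[u ↔ x in n₁+n₂]` on the left, which is automatic on `G_u ∩ {∂n₁ = {x,y}}`;
* `Current.sum_below_binom_switch_local` — the `m`-resolved combinatorial core: for a total current
  `m ∈ G_u`, `∑_{n ≤ m} binom(m,n) 1{∂n={x,y}}1{∂(m-n)=∅} E(n)F(n) = ∑_{n ≤ m} binom(m,n) 1{∂n={x,u}}1{∂(m-n)={u,y}} E(n)F(m-n)`,
  by the involution `𝒩 ↦ 𝒩 Δ 𝒦` on labelled sub-currents (`Current.sum_labelled_eq_sum_binom_ennreal`,
  `Current.sources_symmDiff` of `RandomCurrentsProofs.lean`) with `𝒦` the labelled sub-current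
  "first `k_e` copies of each edge" (`Current.labelOf`);
* `Current.tsum_epairWeight_mul_mul` — the trivial companion (4.11)/(6.15),
  `P^{xu,uy}[n₁ ∈ E, n₂ ∈ F] = P^{xu}[E] P^{uy}[F]` (Fubini).

The multi-current statement (6.14) (pairs `(n_i, n'_i)`, `i ≤ s`) is the product of `s` copies of the
one-pair identity, the event `G(u_1,…,u_t)` and the weights factorising over `i`; it is not spelled out
here. No named fact is introduced; everything is proved.

## References

* M. Aizenman, H. Duminil-Copin, Ann. of Math. 194 (2021), arXiv:1912.07973, §4.2, proof of Prop. 4.6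
  ((4.10), (4.11) and the multigraph argument, pp. 13–14); §6.2, (6.14)–(6.15) (p. 24)
  [AizenmanDuminilCopinAnnals2021].
* M. Aizenman, H. Duminil-Copin, V. Tassion, S. Warzel, *Emergent planarity in two-dimensional Ising
  models with finite-range interactions*, Invent. Math. 216 (2019), arXiv:1801.04960, §3 (generalized
  switching principle) — cited by the source for the mechanism; not used here.
* H. Duminil-Copin, arXiv:1607.06933 (2016), Lemma 2.2 (labelled sub-currents, `𝒩 ↦ 𝒩 Δ 𝒦`) — through
  `RandomCurrentsProofs.lean`.
-/

noncomputable section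

open Finset Filter
open scoped symmDiff ENNReal

namespace Literature.Probability.LatticeModels

variable {V : Type*} [Fintype V] [DecidableEq V] {G : SimpleGraph V} [DecidableRel G.Adj]

namespace Current

/-! ### Labelled sub-currents: counting in `ℝ≥0∞`, the labelled sub-current of a current -/

/-- **Counting labelled sub-currents, `ℝ≥0∞` form** of the tree's `Current.sum_labelled_eq_sum_binom`:
`∑_T c(|T|) = ∑_{n ≤ m} binom(m,n) c(n)` over families `T e ⊆ Fin (m e)`. [cite: DuminilCopin2016, Lemma 2.2 (proof)] -/
theorem sum_labelled_eq_sum_binom_ennreal (m : Current G) (c : Current G → ℝ≥0∞) :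
    ∑ T : (e : G.edgeFinset) → Finset (Fin (m e)), c (fun e => (T e).card) =
      ∑ n ∈ m.below, (binom m n : ℝ≥0∞) * c n := by
  classical
  have hmaps : ∀ T ∈ (univ : Finset ((e : G.edgeFinset) → Finset (Fin (m e)))),
      (fun e => (T e).card) ∈ m.below := by
    intro T _
    rw [mem_below_iff]
    intro e
    exact (Finset.card_le_univ (T e)).trans (by simp)
  rw [← Finset.sum_fiberwise_of_maps_to hmaps]
  refine Finset.sum_congr rfl fun n _ => ?_
  have hfib : (univ : Finset ((e : G.edgeFinset) → Finset (Fin (m e)))).filter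
      (fun T => (fun e => (T e).card) = n) =
      Fintype.piFinset fun e : G.edgeFinset => Finset.powersetCard (n e) univ := by
    ext T
    simp only [Finset.mem_filter, Finset.mem_univ, true_and, Fintype.mem_piFinset,
      Finset.mem_powersetCard, Finset.subset_univ, funext_iff]
  rw [Finset.sum_congr rfl fun T hT => by rw [(Finset.mem_filter.1 hT).2], Finset.sum_const, hfib,
    Fintype.card_piFinset, nsmul_eq_mul]
  congr 1
  unfold binom
  rw [Nat.cast_prod, Nat.cast_prod]
  refine Finset.prod_congr rfl fun e _ => ?_
  rw [Finset.card_powersetCard, Finset.card_univ, Fintype.card_fin]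

/-- **The labelled sub-current of `k ≤ m`**: the first `k_e` of the `m_e` copies of each edge `e`
(the subgraph `𝒦 ⊂ ℳ` "guaranteed by the existence of `𝐤`" in the source).
[cite: AizenmanDuminilCopinAnnals2021, arXiv:1912.07973 §4.2, proof of Prop. 4.6 (the subgraph 𝒦) (p. 13)] -/
def labelOf (m k : Current G) (e : G.edgeFinset) : Finset (Fin (m e)) :=
  univ.filter fun i => (i : ℕ) < k e

omit [DecidableEq V] in
/-- `|labelOf m k e| = k_e` for `k ≤ m`. [folklore] -/
theorem card_labelOf {m k : Current G} (h : k ≤ m) (e : G.edgeFinset) : (labelOf m k e).card = k e := by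
  unfold labelOf
  have hk : k e ≤ m e := h e
  have h1 : ((univ : Finset (Fin (m e))).filter fun i : Fin (m e) => (i : ℕ) < k e).card =
      (Finset.range (k e)).card := by
    refine Finset.card_bij (fun i _ => (i : ℕ)) (fun i hi => ?_) (fun i _ j _ hij => Fin.ext hij) (fun j hj => ?_)
    · rw [Finset.mem_filter] at hi
      exact Finset.mem_range.2 hi.2
    · rw [Finset.mem_range] at hj
      exact ⟨⟨j, lt_of_lt_of_le hj hk⟩, Finset.mem_filter.2 ⟨Finset.mem_univ _, hj⟩, rfl⟩
  rw [h1, Finset.card_range]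

omit [DecidableEq V] in
/-- The underlying current of `labelOf m k` is `k` (`k ≤ m`). [folklore] -/
theorem card_labelOf_eq {m k : Current G} (h : k ≤ m) : (fun e => (labelOf m k e).card) = k :=
  funext fun e => card_labelOf h e

omit [DecidableEq V] in
/-- Where `k_e = 0` the label set is empty. [folklore] -/
theorem labelOf_eq_empty {m k : Current G} {e : G.edgeFinset} (he : k e = 0) : labelOf m k e = ∅ := by
  unfold labelOf
  rw [he]
  exact Finset.filter_false_of_mem fun i _ => Nat.not_lt_zero _

omit [DecidableEq V] in
/-- Where `k_e = m_e` the label set is everything. [folklore] -/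
theorem labelOf_eq_univ {m k : Current G} {e : G.edgeFinset} (he : k e = m e) : labelOf m k e = univ := by
  unfold labelOf
  rw [he]
  exact Finset.filter_true_of_mem fun i _ => i.2

/-! ### The split event `G(u)` (locality of `E`, `F` is Mathlib's `DependsOn`) -/

/-- **The split event `G(u)`** of Aizenman–Duminil-Copin 2021 for the total current `m = n₁ + n₂`:
"there exists `𝐤 ≤ n₁+n₂` such that `𝐤 = 0` on `Λ_n` [the edge set `E_in`], `𝐤 = n₁+n₂` outside `Λ_N`
[the edge set `E_out`], and `∂𝐤 = {u,y}`". [cite: AizenmanDuminilCopinAnnals2021, arXiv:1912.07973 §4.2, proof of Prop. 4.6 (event G(y), p. 13); §6.2 (event G(u₁,…,u_t), p. 24)] -/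
def SplitEvent (Ein Eout : Finset G.edgeFinset) (u y : V) (m : Current G) : Prop :=
  ∃ k : Current G, k ≤ m ∧ (∀ e ∈ Ein, k e = 0) ∧ (∀ e ∈ Eout, k e = m e) ∧ k.sources = {u} ∆ {y}

/-! ### The combinatorial core at fixed total current -/

omit [DecidableEq V] in
/-- The underlying current of a labelled sub-current is below `m`. [folklore] -/
theorem card_le {m : Current G} (T : (e : G.edgeFinset) → Finset (Fin (m e))) : (fun e => (T e).card) ≤ m :=
  fun e => (Finset.card_le_univ (T e)).trans (by simp)

/-- **The localized switching at fixed total current** (the multigraph identity of the source): if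
`m ∈ G_u` (witness `k`), `E` is local on `E_in`, `F` is local on `E_out`, then
`∑_{n ≤ m} binom(m,n) 1{∂n = {x}Δ{y}} 1{∂(m-n) = ∅} E(n) F(n) = ∑_{n ≤ m} binom(m,n) 1{∂n = {x}Δ{u}} 1{∂(m-n) = {u}Δ{y}} E(n) F(m-n)`
— the involution `𝒩 ↦ 𝒩 Δ 𝒦` (`𝒦` the labels of `k`) maps `∂𝒩` to `∂𝒩 Δ {u,y}`, does not change `𝒩`
on `E_in` and complements it inside `ℳ` on `E_out`. [cite: AizenmanDuminilCopinAnnals2021, arXiv:1912.07973 §4.2, proof of Prop. 4.6 (display after (4.10), p. 13–14)] -/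
theorem sum_below_binom_switch_local {Ein Eout : Finset G.edgeFinset} {u y : V} {m : Current G}
    (hG : SplitEvent Ein Eout u y m) (x : V) {E F : Current G → ℝ≥0∞}
    (hE : DependsOn E (↑Ein : Set G.edgeFinset)) (hF : DependsOn F (↑Eout : Set G.edgeFinset)) :
    ∑ n ∈ m.below, (binom m n : ℝ≥0∞) *
        ((if n.sources = {x} ∆ {y} then 1 else 0) * (if (m - n).sources = ∅ then 1 else 0) * (E n * F n)) =
      ∑ n ∈ m.below, (binom m n : ℝ≥0∞) *
        ((if n.sources = {x} ∆ {u} then 1 else 0) * (if (m - n).sources = {u} ∆ {y} then 1 else 0) *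
          (E n * F (m - n))) := by
  classical
  obtain ⟨k, hkm, hkin, hkout, hks⟩ := hG
  -- both sides as sums over labelled sub-currents
  set Φ₁ : Current G → ℝ≥0∞ := fun n =>
    (if n.sources = {x} ∆ {y} then 1 else 0) * (if (m - n).sources = ∅ then 1 else 0) * (E n * F n) with hΦ₁
  set Φ₂ : Current G → ℝ≥0∞ := fun n =>
    (if n.sources = {x} ∆ {u} then 1 else 0) * (if (m - n).sources = {u} ∆ {y} then 1 else 0) *
      (E n * F (m - n)) with hΦ₂
  rw [← sum_labelled_eq_sum_binom_ennreal m Φ₁, ← sum_labelled_eq_sum_binom_ennreal m Φ₂]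
  -- the labelled `𝒦` and the involution
  set 𝒦 : (e : G.edgeFinset) → Finset (Fin (m e)) := labelOf m k with h𝒦
  have h𝒦k : (fun e => (𝒦 e).card) = k := card_labelOf_eq hkm
  refine Finset.sum_bij (fun T _ => fun e => (T e) ∆ (𝒦 e)) (fun _ _ => Finset.mem_univ _)
    (fun T₁ _ T₂ _ h => ?_) (fun T _ => ⟨fun e => (T e) ∆ (𝒦 e), Finset.mem_univ _, ?_⟩) (fun T _ => ?_)
  · funext e
    exact symmDiff_left_injective _ (congrFun h e)
  · funext e
    simp only
    rw [symmDiff_assoc, symmDiff_self, symmDiff_bot]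
  · -- the summands agree: `Φ₁(|T|) = Φ₂(|T Δ 𝒦|)`
    set n : Current G := fun e => (T e).card with hn
    set n' : Current G := fun e => ((T e) ∆ (𝒦 e)).card with hn'
    have hnm : n ≤ m := card_le T
    have hn'm : n' ≤ m := card_le _
    -- sources
    have hsrc : n'.sources = n.sources ∆ ({u} ∆ {y}) := by
      rw [hn', hn, sources_symmDiff G T 𝒦, h𝒦k, hks]
    -- agreement on `E_in`, complement on `E_out`
    have hin : ∀ e ∈ Ein, n e = n' e := by
      intro e he
      simp only [hn, hn']
      rw [h𝒦, labelOf_eq_empty (hkin e he), show (∅ : Finset (Fin (m e))) = ⊥ from rfl, symmDiff_bot]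
    have hout : ∀ e ∈ Eout, n e = (m - n') e := by
      intro e he
      simp only [hn, hn', Pi.sub_apply]
      rw [h𝒦, labelOf_eq_univ (hkout e he)]
      have h1 : (T e) ∆ univ = (T e)ᶜ := by
        rw [symmDiff_comm]; exact top_symmDiff (T e)
      rw [h1, Finset.card_compl, Fintype.card_fin]
      have : (T e).card ≤ m e := (Finset.card_le_univ (T e)).trans (by simp)
      omega
    have hEeq : E n = E n' := hE fun e he => hin e he
    have hFeq : F n = F (m - n') := hF fun e he => hout e he
    -- the two source indicators correspond
    have hxu : (({x} : Finset V) ∆ {y}) ∆ ({u} ∆ {y}) = {x} ∆ {u} := by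
      rw [symmDiff_comm ({x} : Finset V) {y}, symmDiff_comm ({u} : Finset V) {y}, symmDiff_symmDiff_symmDiff_left]
    have h1 : (n.sources = {x} ∆ {y}) ↔ (n'.sources = {x} ∆ {u}) := by
      rw [hsrc]
      constructor
      · intro h
        rw [h, hxu]
      · intro h
        rw [← hxu] at h
        exact symmDiff_left_inj.1 h
    have h2 : ((m - n).sources = ∅) ↔ ((m - n').sources = {u} ∆ {y}) := by
      rw [sources_tsub G hnm, sources_tsub G hn'm, hsrc]
      constructor
      · intro h
        rw [← symmDiff_assoc, h, empty_symmDiff]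
      · intro h
        rw [← symmDiff_assoc] at h
        have h0 : m.sources ∆ n.sources ∆ ({u} ∆ {y}) = ∅ ∆ ({u} ∆ {y}) := by
          rw [empty_symmDiff]; exact h
        exact symmDiff_left_inj.1 h0
    show Φ₁ n = Φ₂ n'
    simp only [hΦ₁, hΦ₂]
    rw [hEeq, hFeq]
    by_cases ha : n.sources = {x} ∆ {y}
    · rw [if_pos ha, if_pos (h1.1 ha)]
      by_cases hb : (m - n).sources = ∅
      · rw [if_pos hb, if_pos (h2.1 hb)]
      · rw [if_neg hb, if_neg (fun h => hb (h2.2 h))]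
    · rw [if_neg ha, if_neg (fun h => ha (h1.2 h))]
      simp

/-! ### The identity for the pair of currents -/

/-- **Aizenman–Duminil-Copin 2021, (4.10)/(6.14) — the localized switching, one pair of currents,
current-sum form.** For `K ≥ 0`, disjointly supported local functionals `E` (on `E_in`) and `F` (on
`E_out`), vertices `x, y, u`, and the split event `G_u = SplitEvent E_in E_out u y`:
`∑ 1{∂n₁={x}Δ{y}}1{∂n₂=∅} w w E(n₁)F(n₁) 𝟙[G_u(n₁+n₂)] = ∑ 1{∂n₁={x}Δ{u}}1{∂n₂={u}Δ{y}} w w E(n₁)F(n₂) 𝟙[G_u(n₁+n₂)]`,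
i.e. `P^{xy,∅}[n₁ ∈ E ∩ F, G(u)] · Z[xy]Z[∅] = P^{xu,uy}[n₁ ∈ E, n₂ ∈ F, G(u)] · Z[xu]Z[uy]`.
[cite: AizenmanDuminilCopinAnnals2021, arXiv:1912.07973 §4.2, (4.10) (p. 13); §6.2, (6.14) (p. 24)] -/
theorem tsum_epairWeight_switch_local {K : G.edgeFinset → ℝ} (hK : ∀ e, 0 ≤ K e)
    (Ein Eout : Finset G.edgeFinset) (x y u : V) [DecidablePred (SplitEvent Ein Eout u y)]
    {E F : Current G → ℝ≥0∞} (hE : DependsOn E (↑Ein : Set G.edgeFinset))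
    (hF : DependsOn F (↑Eout : Set G.edgeFinset)) :
    ∑' p : Current G × Current G, epairWeight K ({x} ∆ {y}) ∅ p *
        (E p.1 * F p.1 * (if SplitEvent Ein Eout u y (p.1 + p.2) then 1 else 0)) =
      ∑' p : Current G × Current G, epairWeight K ({x} ∆ {u}) ({u} ∆ {y}) p *
        (E p.1 * F p.2 * (if SplitEvent Ein Eout u y (p.1 + p.2) then 1 else 0)) := by
  classical
  -- both sides as `∑_m w(m) ∑_{n ≤ m} binom …`
  have hL := tsum_prod_eweight_mul_eq hK (fun n₁ n₂ =>
    (if n₁.sources = {x} ∆ {y} then 1 else 0) * (if n₂.sources = ∅ then 1 else 0) *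
      (E n₁ * F n₁ * (if SplitEvent Ein Eout u y (n₁ + n₂) then 1 else 0)))
  have hR := tsum_prod_eweight_mul_eq hK (fun n₁ n₂ =>
    (if n₁.sources = {x} ∆ {u} then 1 else 0) * (if n₂.sources = {u} ∆ {y} then 1 else 0) *
      (E n₁ * F n₂ * (if SplitEvent Ein Eout u y (n₁ + n₂) then 1 else 0)))
  have hL' : (∑' p : Current G × Current G, epairWeight K ({x} ∆ {y}) ∅ p *
      (E p.1 * F p.1 * (if SplitEvent Ein Eout u y (p.1 + p.2) then 1 else 0))) =
      ∑' p : Current G × Current G, p.1.eweight K * p.2.eweight K *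
        ((if p.1.sources = {x} ∆ {y} then 1 else 0) * (if p.2.sources = ∅ then 1 else 0) *
          (E p.1 * F p.1 * (if SplitEvent Ein Eout u y (p.1 + p.2) then 1 else 0))) :=
    tsum_congr fun p => epairWeight_mul_eq K _ _ p _
  have hR' : (∑' p : Current G × Current G, epairWeight K ({x} ∆ {u}) ({u} ∆ {y}) p *
      (E p.1 * F p.2 * (if SplitEvent Ein Eout u y (p.1 + p.2) then 1 else 0))) =
      ∑' p : Current G × Current G, p.1.eweight K * p.2.eweight K *
        ((if p.1.sources = {x} ∆ {u} then 1 else 0) * (if p.2.sources = {u} ∆ {y} then 1 else 0) *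
          (E p.1 * F p.2 * (if SplitEvent Ein Eout u y (p.1 + p.2) then 1 else 0))) :=
    tsum_congr fun p => epairWeight_mul_eq K _ _ p _
  rw [hL', hR', hL, hR]
  refine tsum_congr fun m => ?_
  congr 1
  -- at fixed `m`: `n + (m - n) = m`, and the combinatorial core
  have hadd : ∀ n ∈ m.below, n + (m - n) = m := fun n hn => add_tsub_cancel_of_le (mem_below_iff.1 hn)
  by_cases hG : SplitEvent Ein Eout u y m
  · have h := sum_below_binom_switch_local hG x hE hF
    calc ∑ n ∈ m.below, (binom m n : ℝ≥0∞) * ((if n.sources = {x} ∆ {y} then 1 else 0) *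
          (if (m - n).sources = ∅ then 1 else 0) *
          (E n * F n * (if SplitEvent Ein Eout u y (n + (m - n)) then 1 else 0)))
        = ∑ n ∈ m.below, (binom m n : ℝ≥0∞) * ((if n.sources = {x} ∆ {y} then 1 else 0) *
            (if (m - n).sources = ∅ then 1 else 0) * (E n * F n)) := by
          refine Finset.sum_congr rfl fun n hn => ?_
          rw [hadd n hn, if_pos hG, mul_one]
      _ = ∑ n ∈ m.below, (binom m n : ℝ≥0∞) * ((if n.sources = {x} ∆ {u} then 1 else 0) *
            (if (m - n).sources = {u} ∆ {y} then 1 else 0) * (E n * F (m - n))) := h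
      _ = _ := by
          refine Finset.sum_congr rfl fun n hn => ?_
          rw [hadd n hn, if_pos hG, mul_one]
  · rw [Finset.sum_eq_zero fun n hn => by rw [hadd n hn, if_neg hG]; simp,
      Finset.sum_eq_zero fun n hn => by rw [hadd n hn, if_neg hG]; simp]

/-- On `G_u ∩ {∂n₁ = {x}Δ{y}}` the vertex `u` is connected to `x` in `n₁ + n₂` (`x ↔ y` along `n₁`,
`y ↔ u` along the witness `k ≤ n₁+n₂`). [cite: AizenmanDuminilCopinAnnals2021, arXiv:1912.07973 §4.2, proof of Prop. 4.6 (p. 13)] -/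
theorem mem_cluster_of_splitEvent {Ein Eout : Finset G.edgeFinset} {u x y : V} {n₁ n₂ : Current G}
    (hs : n₁.sources = {x} ∆ {y}) (hG : SplitEvent Ein Eout u y (n₁ + n₂)) : u ∈ (n₁ + n₂).cluster x := by
  obtain ⟨k, hkm, -, -, hks⟩ := hG
  have hyx : y ∈ (n₁ + n₂).cluster x :=
    cluster_mono (le_self_add : n₁ ≤ n₁ + n₂) x (mem_cluster_of_sources_eq hs)
  have huy : u ∈ (n₁ + n₂).cluster y := by
    rw [symmDiff_comm] at hks
    exact cluster_mono hkm y (mem_cluster_of_sources_eq hks)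
  exact mem_cluster_trans hyx huy

/-- **(4.10)/(6.14) as printed, with the connection indicator**: the left side carries
`𝟙[u ↔ x in n₁+n₂]` in the source; it is automatic on the support.
`∑ 1{xy}1{∅} w w E(n₁)F(n₁) 𝟙[u ↔ x] 𝟙[G_u] = ∑ 1{xu}1{uy} w w E(n₁)F(n₂) 𝟙[G_u]`.
[cite: AizenmanDuminilCopinAnnals2021, arXiv:1912.07973 §4.2, (4.10) (p. 13); §6.2, (6.14) (p. 24)] -/
theorem tsum_epairWeight_switch_local_conn {K : G.edgeFinset → ℝ} (hK : ∀ e, 0 ≤ K e)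
    (Ein Eout : Finset G.edgeFinset) (x y u : V) [DecidablePred (SplitEvent Ein Eout u y)]
    {E F : Current G → ℝ≥0∞} (hE : DependsOn E (↑Ein : Set G.edgeFinset))
    (hF : DependsOn F (↑Eout : Set G.edgeFinset)) :
    ∑' p : Current G × Current G, epairWeight K ({x} ∆ {y}) ∅ p *
        (E p.1 * F p.1 * (if u ∈ (p.1 + p.2).cluster x then 1 else 0) *
          (if SplitEvent Ein Eout u y (p.1 + p.2) then 1 else 0)) =
      ∑' p : Current G × Current G, epairWeight K ({x} ∆ {u}) ({u} ∆ {y}) p *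
        (E p.1 * F p.2 * (if SplitEvent Ein Eout u y (p.1 + p.2) then 1 else 0)) := by
  rw [← tsum_epairWeight_switch_local hK Ein Eout x y u hE hF]
  refine tsum_congr fun p => ?_
  by_cases hs : p.1.sources = {x} ∆ {y}
  · by_cases hG : SplitEvent Ein Eout u y (p.1 + p.2)
    · rw [if_pos (mem_cluster_of_splitEvent hs hG), mul_one]
    · simp only [if_neg hG, mul_zero]
  · rw [epairWeight_eq_mul, if_neg hs, zero_mul, zero_mul, zero_mul]

/-- **(4.11)/(6.15), the trivial identity** `P^{xu,uy}[n₁ ∈ E, n₂ ∈ F] = P^{xu}[E] P^{uy}[F]`, current-sum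
form: `∑ 1{∂n₁=A}1{∂n₂=B} w w E(n₁) F(n₂) = (∑ 1{∂n=A} w E) (∑ 1{∂n=B} w F)` (Fubini).
[cite: AizenmanDuminilCopinAnnals2021, arXiv:1912.07973 §4.2, (4.11) (p. 14); §6.2, (6.15) (p. 24)] -/
theorem tsum_epairWeight_mul_mul (K : G.edgeFinset → ℝ) (A B : Finset V) (E F : Current G → ℝ≥0∞) :
    ∑' p : Current G × Current G, epairWeight K A B p * (E p.1 * F p.2) =
      (∑' n : Current G, (if n.sources = A then n.eweight K else 0) * E n) *
        ∑' n : Current G, (if n.sources = B then n.eweight K else 0) * F n := by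
  rw [tsum_mul_tsum_eq_tsum_prod]
  refine tsum_congr fun p => ?_
  rw [epairWeight_eq_mul]
  ring

end Current

end Literature.Probability.LatticeModels
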